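import Summits.Ventures.Crystal3D.Bulk.GapActiveFaces
import HarnessLib

/-!
# P-L3(c) FACE SIZES for the GAP census: every oriented face of the tight map has at most six
# darts, and at most five if it avoids the hole (route 1 of `HOME/lean/lemmaL/DESIGN.md`, R1.8)

HONEST FRAMING. Part of the venture `Summits/Ventures/Crystal3D` (cell `pub-crystal3d`, phase 2;
seat p3). Kernel theorem about every configuration satisfying `CensusRows c`; nothing is claimed
about GAP(1.26). Row P-L3(c) of the cell's `DESIGN-L12-THEORY.md` ("x-only faces are 3/4/5-gons,
faces at the hole ≤ 6-gons"), until now an assumption of the census enumeration (plantri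
`-f6`), becomes a census row: by LEMMA L (`CensusRows.orient3_oface_neg`,
`Bulk/GapActiveFaces.lean`) the vertex cycle of an oriented face is a convex spherical polygon,
so by Euclid XI.21 (Literature `sum_angle_lt_two_pi_of_orient3_neg`, PROVED) its perimeter is
`< 2π`; its sides are the tight pairs read along the walk, of length `π/3` (shell–shell) or
`ρ = arccos (D/2) > π/4` (at the hole, `D ≤ 1.26 < √2`), and the hole is passed at most once
(`CensusRows.fst_iterate_ofaceSucc_injOn`):

* `CensusRows.sum_angle_oface_lt_two_pi` — the perimeter of every face walk is `< 2π`;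
* **`CensusRows.ofaceLen_le_six`** — `ofaceLen c q ≤ 6` (`= #(ofaceOf c q)`, `card_ofaceOf`) for
  every dart `q` of the tight map; **`CensusRows.ofaceLen_le_five_of_forall_ne`** — `≤ 5` if no
  dart of the face starts at the hole `13`; `CensusRows.card_oface_le_six / _le_five` — the same
  for `F ∈ ofaces c`.
-/

noncomputable section

namespace Summit.Ventures.Crystal3D

open Literature.Geometry.DiscreteGeometry Finset Real InnerProductGeometry Function

variable {c : Fin 14 → EuclideanSpace ℝ (Fin 3)}

/-! ## The sides of a face walk -/

/-- The tail of `φ°^[t+1] q` is the head of `φ°^[t] q`. -/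
theorem fst_iterate_succ (c : Fin 14 → EuclideanSpace ℝ (Fin 3)) (q : Fin 14 × Fin 14) (t : ℕ) :
    ((ofaceSucc c)^[t + 1] q).1 = ((ofaceSucc c)^[t] q).2 := by
  rw [iterate_succ_apply']; rfl

/-- **The side of a face walk along a tight dart has length `arccos (tightLevel)`**: `π/3`
between two shell balls, `arccos (D/2)` at the hole. -/
theorem CensusRows.angle_gapDir_of_mem_darts (h : CensusRows c) {q : Fin 14 × Fin 14}
    (hq : q ∈ darts c) :
    angle (gapDir c q.1) (gapDir c q.2) = Real.arccos (tightLevel c q.1 q.2) := by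
  obtain ⟨h1, h2, -, hd⟩ := mem_darts.1 hq
  unfold angle
  rw [h.isGapConfig.norm_gapDir h1, h.isGapConfig.norm_gapDir h2, mul_one, div_one,
    h.isGapConfig.inner_gapDir_eq h1 h2 hd]

/-- A shell–shell side has length `π/3`. -/
theorem CensusRows.angle_gapDir_eq_pi_div_three (h : CensusRows c) {q : Fin 14 × Fin 14}
    (hq : q ∈ darts c) (h1 : q.1 ≠ 13) (h2 : q.2 ≠ 13) :
    angle (gapDir c q.1) (gapDir c q.2) = π / 3 := by
  rw [h.angle_gapDir_of_mem_darts hq, tightLevel_of_ne h1 h2, ← Real.cos_pi_div_three,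
    Real.arccos_cos (by positivity) (by linarith [Real.pi_pos])]

/-- Every side has length `> π/4` (the hole radius `arccos (D/2)` exceeds `π/4` as `D < √2`). -/
theorem CensusRows.pi_div_four_lt_angle_gapDir (h : CensusRows c) {q : Fin 14 × Fin 14}
    (hq : q ∈ darts c) : π / 4 < angle (gapDir c q.1) (gapDir c q.2) := by
  rw [h.angle_gapDir_of_mem_darts hq]
  have hpi4 : Real.arccos (√2 / 2) = π / 4 := by
    rw [← Real.cos_pi_div_four, Real.arccos_cos (by positivity) (by linarith [Real.pi_pos])]
  have hD := h.intruderDist_le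
  have hlev : tightLevel c q.1 q.2 < √2 / 2 := by
    have hs : (1.26 : ℝ) / 2 < √2 / 2 := by
      rw [div_lt_div_iff_of_pos_right (by norm_num : (0:ℝ) < 2), Real.lt_sqrt (by norm_num)]
      norm_num
    unfold tightLevel
    split_ifs
    · linarith
    · have : (1:ℝ) / 2 < 1.26 / 2 := by norm_num
      linarith
  have hs1 : √2 / 2 ≤ 1 := by
    have : √2 ≤ 2 := by
      rw [show (2:ℝ) = √4 by rw [show (4:ℝ) = 2 ^ 2 by norm_num, Real.sqrt_sq (by norm_num)]]
      exact Real.sqrt_le_sqrt (by norm_num)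
    linarith
  rw [← hpi4]
  exact Real.arccos_lt_arccos (by linarith [h.isGapConfig.half_le_tightLevel q.1 q.2]) hlev hs1

/-! ## The perimeter of a face walk is `< 2π` -/

/-- **The perimeter of every oriented face is `< 2π`** (LEMMA L + Euclid XI.21): for a dart `q`
of the tight map, `Σ_{t < ofaceLen} ∠(u_{tail φ°^[t] q}, u_{head φ°^[t] q}) < 2π`. -/
theorem CensusRows.sum_angle_oface_lt_two_pi (h : CensusRows c) {q : Fin 14 × Fin 14}
    (hq : q ∈ darts c) :
    ∑ t ∈ range (ofaceLen c q),
      angle (gapDir c ((ofaceSucc c)^[t] q).1) (gapDir c ((ofaceSucc c)^[t] q).2) < 2 * π := by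
  set m := ofaceLen c q with hm
  have h3 : 3 ≤ m := h.three_le_ofaceLen hq
  have hper := sum_angle_lt_two_pi_of_orient3_neg h3
    (v := fun t => gapDir c ((ofaceSucc c)^[t] q).1)
    (fun i j k hij hjk hk => h.orient3_oface_neg hq hij hjk hk)
  -- rewrite the heads as the next tails, and close the cycle
  have hlast : gapDir c ((ofaceSucc c)^[m - 1] q).2 = gapDir c ((ofaceSucc c)^[0] q).1 := by
    rw [← fst_iterate_succ, show m - 1 + 1 = m by omega, hm, iterate_ofaceLen]; rfl
  rw [show m = (m - 1) + 1 by omega, Finset.sum_range_succ, hlast]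
  have hterm : ∀ t ∈ range (m - 1), angle (gapDir c ((ofaceSucc c)^[t] q).1)
      (gapDir c ((ofaceSucc c)^[t] q).2) = angle (gapDir c ((ofaceSucc c)^[t] q).1)
      (gapDir c ((ofaceSucc c)^[t + 1] q).1) := by
    intro t _; rw [fst_iterate_succ]
  rw [Finset.sum_congr rfl hterm]
  exact hper

/-! ## Face sizes -/

/-- The darts of the walk are darts of the tight map. -/
theorem CensusRows.iterate_ofaceSucc_mem_darts (h : CensusRows c) {q : Fin 14 × Fin 14}
    (hq : q ∈ darts c) (t : ℕ) : (ofaceSucc c)^[t] q ∈ darts c :=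
  h.isGapConfig.iterate_ofaceSucc_mem_darts h.intruderDist_bounds.1 hq t

/-- **x-faces have at most five sides.** If no dart of the face of `q` starts at the hole, then
`ofaceLen c q ≤ 5`: the perimeter is `ofaceLen · π/3 < 2π`. -/
theorem CensusRows.ofaceLen_le_five_of_forall_ne (h : CensusRows c) {q : Fin 14 × Fin 14}
    (hq : q ∈ darts c) (hx : ∀ t, t < ofaceLen c q → ((ofaceSucc c)^[t] q).1 ≠ 13) :
    ofaceLen c q ≤ 5 := by
  set m := ofaceLen c q with hm
  have hP := h.sum_angle_oface_lt_two_pi hq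
  rw [← hm] at hP
  have hterm : ∀ t ∈ range m, angle (gapDir c ((ofaceSucc c)^[t] q).1)
      (gapDir c ((ofaceSucc c)^[t] q).2) = π / 3 := by
    intro t ht
    rw [mem_range] at ht
    refine h.angle_gapDir_eq_pi_div_three (h.iterate_ofaceSucc_mem_darts hq t) (hx t ht) ?_
    rw [← fst_iterate_succ]
    rcases Nat.lt_or_ge (t + 1) m with h1 | h1
    · exact hx (t + 1) h1
    · rw [show t + 1 = m by omega, hm, iterate_ofaceLen]
      have := hx 0 (by omega)
      simpa using this
  rw [Finset.sum_congr rfl hterm, Finset.sum_const, card_range, nsmul_eq_mul] at hP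
  by_contra hle
  have h6 : (6 : ℝ) ≤ m := by exact_mod_cast (show 6 ≤ m by omega)
  nlinarith [Real.pi_pos]

/-- **Every face has at most six sides.** `ofaceLen c q ≤ 6` for every dart of the tight map:
the hole is the tail of at most one dart and the head of at most one dart of the walk (the
vertices are distinct), those sides are `> π/4`, the others are `π/3`, and the perimeter is
`< 2π`. -/
theorem CensusRows.ofaceLen_le_six (h : CensusRows c) {q : Fin 14 × Fin 14} (hq : q ∈ darts c) :
    ofaceLen c q ≤ 6 := by
  classical
  set m := ofaceLen c q with hm
  have h3 : 3 ≤ m := h.three_le_ofaceLen hq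
  have hP := h.sum_angle_oface_lt_two_pi hq
  rw [← hm] at hP
  set A : ℕ → ℝ := fun t => angle (gapDir c ((ofaceSucc c)^[t] q).1)
    (gapDir c ((ofaceSucc c)^[t] q).2) with hA
  -- the exceptional indices: darts starting or ending at the hole
  set B := (range m).filter (fun t => ((ofaceSucc c)^[t] q).1 = 13 ∨ ((ofaceSucc c)^[t] q).2 = 13)
    with hB
  -- at most one dart of the walk STARTS at the hole …
  have htail : ((range m).filter fun t => ((ofaceSucc c)^[t] q).1 = 13).card ≤ 1 := by
    rw [Finset.card_le_one]
    intro a ha b hb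
    rw [mem_filter, mem_range] at ha hb
    by_contra hne
    rcases Nat.lt_or_gt_of_ne hne with hlt | hlt
    · exact h.fst_iterate_ofaceSucc_injOn hq hlt hb.1 (by rw [ha.2, hb.2])
    · exact h.fst_iterate_ofaceSucc_injOn hq hlt ha.1 (by rw [ha.2, hb.2])
  -- … and at most one ENDS there (its successor starts there)
  have hhead : ((range m).filter fun t => ((ofaceSucc c)^[t] q).2 = 13).card ≤ 1 := by
    rw [Finset.card_le_one]
    intro a ha b hb
    rw [mem_filter, mem_range] at ha hb
    -- pass to the successor index modulo `m`
    have key : ∀ {a : ℕ}, a < m → ((ofaceSucc c)^[a] q).2 = 13 →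
        ((ofaceSucc c)^[(a + 1) % m] q).1 = 13 := by
      intro a _ h13
      have e : (ofaceSucc c)^[(a + 1) % m] q = (ofaceSucc c)^[a + 1] q := by
        rw [hm]; unfold ofaceLen; exact iterate_mod_minimalPeriod_eq
      rw [e, fst_iterate_succ]; exact h13
    by_contra hne
    have ha' := key ha.1 ha.2
    have hb' := key hb.1 hb.2
    have hma : (a + 1) % m < m := Nat.mod_lt _ (by omega)
    have hmb : (b + 1) % m < m := Nat.mod_lt _ (by omega)
    have hne' : (a + 1) % m ≠ (b + 1) % m := by
      intro heq
      -- `a + 1 ≡ b + 1 (mod m)` with both `≤ m` forces `a = b`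
      have ha1 : a + 1 ≤ m := ha.1
      have hb1 : b + 1 ≤ m := hb.1
      rcases Nat.lt_or_eq_of_le ha1 with hal | hae <;> rcases Nat.lt_or_eq_of_le hb1 with hbl | hbe
      · rw [Nat.mod_eq_of_lt hal, Nat.mod_eq_of_lt hbl] at heq; omega
      · rw [Nat.mod_eq_of_lt hal, hbe, Nat.mod_self] at heq; omega
      · rw [hae, Nat.mod_self, Nat.mod_eq_of_lt hbl] at heq; omega
      · omega
    rcases Nat.lt_or_gt_of_ne hne' with hlt | hlt
    · exact h.fst_iterate_ofaceSucc_injOn hq hlt hmb (by rw [ha', hb'])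
    · exact h.fst_iterate_ofaceSucc_injOn hq hlt hma (by rw [ha', hb'])
  have hBcard : B.card ≤ 2 := by
    rw [hB, filter_or]
    exact (card_union_le _ _).trans (by omega)
  -- split the perimeter
  have hsplit := Finset.sum_filter_add_sum_filter_not (range m)
    (fun t => ((ofaceSucc c)^[t] q).1 = 13 ∨ ((ofaceSucc c)^[t] q).2 = 13) A
  rw [← hB] at hsplit
  have hgood : ∀ t ∈ (range m).filter (fun t => ¬ (((ofaceSucc c)^[t] q).1 = 13 ∨
      ((ofaceSucc c)^[t] q).2 = 13)), A t = π / 3 := by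
    intro t ht
    rw [mem_filter, not_or] at ht
    exact h.angle_gapDir_eq_pi_div_three (h.iterate_ofaceSucc_mem_darts hq t) ht.2.1 ht.2.2
  have hbad : ∀ t ∈ B, π / 4 < A t := fun t _ =>
    h.pi_div_four_lt_angle_gapDir (h.iterate_ofaceSucc_mem_darts hq t)
  have hBsum : (B.card : ℝ) * (π / 4) ≤ ∑ t ∈ B, A t := by
    have := Finset.sum_le_sum fun t ht => (hbad t ht).le
    rw [Finset.sum_const, nsmul_eq_mul] at this
    exact this
  have hGsum : ∑ t ∈ (range m).filter (fun t => ¬ (((ofaceSucc c)^[t] q).1 = 13 ∨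
      ((ofaceSucc c)^[t] q).2 = 13)), A t = (((range m).filter (fun t =>
      ¬ (((ofaceSucc c)^[t] q).1 = 13 ∨ ((ofaceSucc c)^[t] q).2 = 13))).card : ℝ) * (π / 3) := by
    rw [Finset.sum_congr rfl hgood, Finset.sum_const, nsmul_eq_mul]
  have hcards : B.card + ((range m).filter (fun t => ¬ (((ofaceSucc c)^[t] q).1 = 13 ∨
      ((ofaceSucc c)^[t] q).2 = 13))).card = m := by
    rw [hB, Finset.card_filter_add_card_filter_not, card_range]
  -- the total
  have htot : ∑ t ∈ range m, A t < 2 * π := hP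
  rw [← hsplit, hGsum] at htot
  by_contra hle
  have h7 : 7 ≤ m := by omega
  -- `#good = m − #B ≥ m − 2`, so perimeter ≥ #B·π/4 + (m − #B)·π/3 ≥ (m−2)π/3 + 2π/4 > 2π`
  have hG : ((m : ℝ) - B.card) = (((range m).filter (fun t => ¬ (((ofaceSucc c)^[t] q).1 = 13 ∨
      ((ofaceSucc c)^[t] q).2 = 13))).card : ℝ) := by
    have := congrArg (fun n : ℕ => (n : ℝ)) hcards
    push_cast at this
    linarith
  rw [← hG] at htot
  have hB2 : (B.card : ℝ) ≤ 2 := by exact_mod_cast hBcard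
  have hm7 : (7 : ℝ) ≤ m := by exact_mod_cast h7
  nlinarith [Real.pi_pos, hBsum]

/-! ## In terms of the oriented faces `ofaces c` -/

/-- **Every oriented face of the tight map has at most six darts.** -/
theorem CensusRows.card_oface_le_six (h : CensusRows c) {F : Finset (Fin 14 × Fin 14)}
    (hF : F ∈ ofaces c) : F.card ≤ 6 := by
  obtain ⟨q, hq, rfl⟩ := mem_ofaces_iff.1 hF
  rw [card_ofaceOf]; exact h.ofaceLen_le_six hq

/-- **An oriented face none of whose darts starts at the hole has at most five darts.** -/
theorem CensusRows.card_oface_le_five (h : CensusRows c) {F : Finset (Fin 14 × Fin 14)}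
    (hF : F ∈ ofaces c) (hx : ∀ q ∈ F, q.1 ≠ 13) : F.card ≤ 5 := by
  obtain ⟨q, hq, rfl⟩ := mem_ofaces_iff.1 hF
  rw [card_ofaceOf]
  refine h.ofaceLen_le_five_of_forall_ne hq fun t _ => hx _ ?_
  exact (mem_ofaceOf_iff (h.isGapConfig.mem_periodicPts_ofaceSucc h.intruderDist_bounds.1 hq)).2
    ⟨t, rfl⟩

end Summit.Ventures.Crystal3D
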